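import Mathlib
import Literature.Computability.AlgebraicComplexity.LaserHashing
import Literature.Computability.AlgebraicComplexity.XyzFreeDiagonal
import HarnessLib

/-!
# Strassen's free-diagonal theorem for `S₁` — proof file

Sibling proof file of `Literature/Computability/AlgebraicComplexity/XyzFreeDiagonal.lean`,
discharging its named fact `XyzFreeDiagonalHypothesis` (Strassen 1991; Christandl–Vrana–Zuiddam,
arXiv:1709.07851 Thm. 4.4 for the tight set `S₁ = {permutations of (0,1,2)} ⊂ {0,1,2}³` with
uniform marginals): for every `0 < η < 1` and every coordinate set `K` with `|K|` large, the set
`S_K` of coordinatewise-transversal triples of words `K → {0,1,2}` contains a FREE DIAGONAL of size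
`≥ (3-η)^{|K|}`.

## Proof (Coppersmith–Winograd 1990 §6 / Strassen 1991, through the tree's hashing theorem)

* `S_K` has `6^{|K|}` elements (`card_transversal_ge`); sorting them by the triple of letter-count
  vectors ("marginal types", at most `(|K|+1)^9` values) gives one class `Φ` of size
  `≥ 6^{|K|}/(|K|+1)^9` (`exists_big_class`) — pigeonhole instead of the usual uniform type, so no
  multinomial estimates are needed.
* Inside a class the three words live in fixed type classes `I, J, L`; `Φ ⊆ I × J × L` is `2`-tight
  for the coordinates `u ↦ u ∈ ℤ^K`, `v ↦ v`, `w ↦ w - 3` (a transversal column sums to `3`), and all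
  fibres of the three projections have size `≤ 2^{|K|}` (two admissible letters per coordinate, the
  third word being determined).
* The tree's PROVED hashing theorem `BCS1997_thm1539_free` (Bürgisser–Clausen–Shokrollahi Thm. 15.39
  with Coppersmith–Winograd's Salem–Spencer diagonal `exists_zeroSum_diagonal`, Behrend's bound
  `Behrend.roth_lower_bound` from Mathlib, and a prime `6·2^{|K|} < M ≤ 12·2^{|K|}` from Bertrand's
  postulate) yields a diagonal `Δ ⊆ Φ`, free in `Φ`, with
  `|Δ| ≥ |Φ|·|D|·(M-3f)/M³ ≥ 3^{|K|} e^{-4√(log(12·2^{|K|}))} / (96 (|K|+1)^9)`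
  (`exists_freeDiagonal_card_ge`). Freeness in `Φ` is freeness in `S_K`, because membership in the
  type classes is automatic for coordinates of elements of `Δ`.
* The subexponential losses are absorbed: `(3-η)^k ≤ 3^k e^{-4√(log(12·2^k))}/(96(k+1)^9)` for
  `k ≥ k₀(η)` (`eventually_le_bound`), whence `XyzFreeDiagonalHypothesis_holds`.

References: V. Strassen, J. reine angew. Math. 413 (1991) 127–180 [Strassen1991]; D. Coppersmith,
S. Winograd, J. Symbolic Comput. 9 (1990) §6 [CoppersmithWinograd1990]; P. Bürgisser, M. Clausen,
M. A. Shokrollahi, Algebraic Complexity Theory (1997) Thm. 15.39 [BurgisserClausenShokrollahi1997];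
M. Christandl, P. Vrana, J. Zuiddam, JAMS 36 (2023), arXiv:1709.07851 Thm. 4.4
[ChristandlVranaZuiddam2023].
-/

open scoped BigOperators
open Finset Real Filter Topology

namespace Literature.Computability.AlgebraicComplexity

namespace XyzFreeDiagonal

variable {K : Type} [Fintype K] [DecidableEq K]

/-! ## Words, transversal triples, and their number -/

/-- The six transversal letter columns: permutations of `(0,1,2)` as triples. [folklore] -/
def letterTriples : Finset (Fin 3 × Fin 3 × Fin 3) :=
  univ.filter fun t => t.1 ≠ t.2.1 ∧ t.1 ≠ t.2.2 ∧ t.2.1 ≠ t.2.2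

/-- There are six of them. [folklore] -/
private theorem card_letterTriples : letterTriples.card = 6 := by decide

/-- `S_K`: the coordinatewise-transversal triples of words `K → Fin 3`. [cite: Strassen1991, §6] -/
def transversal (K : Type) [Fintype K] [DecidableEq K] :
    Finset ((K → Fin 3) × (K → Fin 3) × (K → Fin 3)) :=
  univ.filter fun x => ∀ i, x.1 i ≠ x.2.1 i ∧ x.1 i ≠ x.2.2 i ∧ x.2.1 i ≠ x.2.2 i

omit [DecidableEq K] in
/-- Membership in `S_K`. [folklore] -/
private theorem mem_transversal [DecidableEq K] {x : (K → Fin 3) × (K → Fin 3) × (K → Fin 3)} :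
    x ∈ transversal K ↔ ∀ i, x.1 i ≠ x.2.1 i ∧ x.1 i ≠ x.2.2 i ∧ x.2.1 i ≠ x.2.2 i := by
  simp [transversal]

/-- `|S_K| ≥ 6^{|K|}` (in fact equality): choose a transversal column in every coordinate.
[folklore] -/
private theorem card_transversal_ge : 6 ^ Fintype.card K ≤ (transversal K).card := by
  classical
  set P : Finset (K → Fin 3 × Fin 3 × Fin 3) := Fintype.piFinset fun _ => letterTriples with hP
  have hPc : P.card = 6 ^ Fintype.card K := by
    rw [hP, Fintype.card_piFinset]; simp [card_letterTriples]
  let g : (K → Fin 3 × Fin 3 × Fin 3) → (K → Fin 3) × (K → Fin 3) × (K → Fin 3) :=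
    fun h => (fun i => (h i).1, fun i => (h i).2.1, fun i => (h i).2.2)
  have hg : Set.InjOn g ↑P := by
    intro h _ h' _ hh
    funext i
    have h1 : (g h).1 i = (g h').1 i := by rw [hh]
    have h2 : (g h).2.1 i = (g h').2.1 i := by rw [hh]
    have h3 : (g h).2.2 i = (g h').2.2 i := by rw [hh]
    exact Prod.ext h1 (Prod.ext h2 h3)
  have hmaps : ∀ h ∈ P, g h ∈ transversal K := by
    intro h hh
    rw [mem_transversal]
    intro i
    have := Fintype.mem_piFinset.1 (hP ▸ hh) i
    simpa [letterTriples] using this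
  calc 6 ^ Fintype.card K = P.card := hPc.symm
    _ ≤ (transversal K).card := Finset.card_le_card_of_injOn g hmaps hg

/-! ## Marginal types and the pigeonhole -/

/-- The letter-count vector of a word. [folklore] -/
def letterCount (u : K → Fin 3) : Fin 3 → Fin (Fintype.card K + 1) :=
  fun a => ⟨(univ.filter fun i => u i = a).card,
    Nat.lt_succ_of_le ((card_filter_le _ _).trans (by rw [Finset.card_univ]))⟩

/-- The marginal-type space: three letter-count vectors. [folklore] -/
abbrev MType (K : Type) [Fintype K] :=
  (Fin 3 → Fin (Fintype.card K + 1)) × (Fin 3 → Fin (Fintype.card K + 1)) ×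
    (Fin 3 → Fin (Fintype.card K + 1))

/-- The marginal type of a triple of words. [folklore] -/
def mtype (x : (K → Fin 3) × (K → Fin 3) × (K → Fin 3)) : MType K :=
  (letterCount x.1, letterCount x.2.1, letterCount x.2.2)

omit [DecidableEq K] in
/-- There are `(|K|+1)^9` marginal types. [folklore] -/
private theorem card_mtype : Fintype.card (MType K) = (Fintype.card K + 1) ^ 9 := by
  simp only [MType, Fintype.card_prod, Fintype.card_fun, Fintype.card_fin]
  ring

/-- PIGEONHOLE: some marginal type carries at least `6^{|K|}/(|K|+1)^9` transversal triples.
[folklore] -/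
private theorem exists_big_class : ∃ t : MType K,
    6 ^ Fintype.card K ≤ (Fintype.card K + 1) ^ 9 * ((transversal K).filter fun x => mtype x = t).card := by
  classical
  obtain ⟨t, -, ht⟩ := exists_max_image (univ : Finset (MType K))
    (fun t => ((transversal K).filter fun x => mtype x = t).card) univ_nonempty
  refine ⟨t, ?_⟩
  have hsum : (transversal K).card =
      ∑ s : MType K, ((transversal K).filter fun x => mtype x = s).card :=
    Finset.card_eq_sum_card_fiberwise fun x _ => mem_univ (mtype x)
  have hle : ∑ s : MType K, ((transversal K).filter fun x => mtype x = s).card ≤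
      (univ : Finset (MType K)).card • ((transversal K).filter fun x => mtype x = t).card :=
    Finset.sum_le_card_nsmul _ _ _ fun s _ => ht s (mem_univ s)
  rw [smul_eq_mul, Finset.card_univ, card_mtype] at hle
  exact card_transversal_ge.trans (hsum ▸ hle)

/-! ## One class as a tight set with small fibres -/

section OneClass

variable (τ : MType K)

/-- The first type class. [folklore] -/
abbrev ClsI := {u : K → Fin 3 // letterCount u = τ.1}
/-- The second type class. [folklore] -/
abbrev ClsJ := {u : K → Fin 3 // letterCount u = τ.2.1}
/-- The third type class. [folklore] -/
abbrev ClsL := {u : K → Fin 3 // letterCount u = τ.2.2}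

/-- Forgetting the class labels. [folklore] -/
def forget : ClsI τ × ClsJ τ × ClsL τ ↪ (K → Fin 3) × (K → Fin 3) × (K → Fin 3) :=
  ⟨fun φ => (φ.1.1, φ.2.1.1, φ.2.2.1), by
    intro φ ψ h
    simp only [Prod.mk.injEq] at h
    exact Prod.ext (Subtype.ext h.1) (Prod.ext (Subtype.ext h.2.1) (Subtype.ext h.2.2))⟩

/-- The class `Φ_τ ⊆ I × J × L` of transversal triples of marginal type `τ`. [folklore] -/
def cls : Finset (ClsI τ × ClsJ τ × ClsL τ) :=
  univ.filter fun φ => forget τ φ ∈ transversal K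

/-- `Φ_τ` forgets onto the `τ`-fibre of `S_K`. [folklore] -/
private theorem map_cls : (cls τ).map (forget τ) = (transversal K).filter fun x => mtype x = τ := by
  ext x
  simp only [cls, Finset.mem_map, mem_filter, mem_univ, true_and]
  constructor
  · rintro ⟨φ, hφ, rfl⟩
    refine ⟨hφ, ?_⟩
    simp only [mtype, forget, Function.Embedding.coeFn_mk]
    rw [φ.1.2, φ.2.1.2, φ.2.2.2]
  · rintro ⟨hx, ht⟩
    have h1 : letterCount x.1 = τ.1 := by rw [← ht]; rfl
    have h2 : letterCount x.2.1 = τ.2.1 := by rw [← ht]; rfl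
    have h3 : letterCount x.2.2 = τ.2.2 := by rw [← ht]; rfl
    exact ⟨(⟨x.1, h1⟩, ⟨x.2.1, h2⟩, ⟨x.2.2, h3⟩), hx, rfl⟩

/-- Hence `|Φ_τ|` is the size of the `τ`-fibre. [folklore] -/
private theorem card_cls : (cls τ).card = ((transversal K).filter fun x => mtype x = τ).card := by
  rw [← map_cls, card_map]

/-- In `Fin 3`, two letters avoiding the same two distinct letters coincide. [folklore] -/
private theorem fin3_third_unique : ∀ a b c d : Fin 3, a ≠ b → a ≠ c → b ≠ c → a ≠ d → b ≠ d → c = d := by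
  decide

/-- A transversal column sums to `3`. [folklore] -/
private theorem fin3_sum_of_distinct : ∀ a b c : Fin 3, a ≠ b → a ≠ c → b ≠ c →
    (a : ℕ) + b + c = 3 := by
  decide

/-- Each letter has exactly two other letters. [folklore] -/
private theorem card_ne_letter (c : Fin 3) : (univ.filter fun b : Fin 3 => b ≠ c).card = 2 := by
  fin_cases c <;> decide

/-- Words avoiding a given word coordinatewise: `2^{|K|}` of them. [folklore] -/
private theorem card_avoid (u : K → Fin 3) :
    (Fintype.piFinset fun i => univ.filter fun b : Fin 3 => b ≠ u i).card = 2 ^ Fintype.card K := by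
  rw [Fintype.card_piFinset]; simp [card_ne_letter]

/-- Fibres of `Φ_τ` over the first word have size `≤ 2^{|K|}`. [folklore] -/
private theorem fibre_fst_le (a : ClsI τ) :
    ((cls τ).filter fun φ => φ.1 = a).card ≤ 2 ^ Fintype.card K := by
  classical
  rw [← card_avoid a.1]
  refine Finset.card_le_card_of_injOn (fun φ => φ.2.1.1) ?_ ?_
  · intro φ hφ
    simp only [coe_filter, Set.mem_setOf_eq, cls, mem_filter, mem_univ, true_and, mem_transversal,
      forget, Function.Embedding.coeFn_mk] at hφ
    obtain ⟨hT, rfl⟩ := hφ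
    exact Finset.mem_coe.2 (Fintype.mem_piFinset.2 fun i =>
      Finset.mem_filter.2 ⟨Finset.mem_univ _, (hT i).1.symm⟩)
  · intro φ hφ ψ hψ h
    simp only [coe_filter, Set.mem_setOf_eq, cls, mem_filter, mem_univ, true_and, mem_transversal,
      forget, Function.Embedding.coeFn_mk] at hφ hψ
    obtain ⟨hTφ, h1φ⟩ := hφ
    obtain ⟨hTψ, h1ψ⟩ := hψ
    have hv : φ.2.1 = ψ.2.1 := Subtype.ext h
    have hw : φ.2.2 = ψ.2.2 := by
      apply Subtype.ext; funext i
      have e1 : φ.1.1 i = ψ.1.1 i := by rw [h1φ, h1ψ]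
      have e2 : φ.2.1.1 i = ψ.2.1.1 i := by rw [hv]
      exact fin3_third_unique _ _ _ _ (hTφ i).1 (hTφ i).2.1 (hTφ i).2.2
        (by rw [e1]; exact (hTψ i).2.1) (by rw [e2]; exact (hTψ i).2.2)
    exact Prod.ext (h1φ.trans h1ψ.symm) (Prod.ext hv hw)

/-- Fibres of `Φ_τ` over the second word have size `≤ 2^{|K|}`. [folklore] -/
private theorem fibre_snd_le (b : ClsJ τ) :
    ((cls τ).filter fun φ => φ.2.1 = b).card ≤ 2 ^ Fintype.card K := by
  classical
  rw [← card_avoid b.1]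
  refine Finset.card_le_card_of_injOn (fun φ => φ.1.1) ?_ ?_
  · intro φ hφ
    simp only [coe_filter, Set.mem_setOf_eq, cls, mem_filter, mem_univ, true_and, mem_transversal,
      forget, Function.Embedding.coeFn_mk] at hφ
    obtain ⟨hT, rfl⟩ := hφ
    exact Finset.mem_coe.2 (Fintype.mem_piFinset.2 fun i =>
      Finset.mem_filter.2 ⟨Finset.mem_univ _, (hT i).1⟩)
  · intro φ hφ ψ hψ h
    simp only [coe_filter, Set.mem_setOf_eq, cls, mem_filter, mem_univ, true_and, mem_transversal,
      forget, Function.Embedding.coeFn_mk] at hφ hψ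
    obtain ⟨hTφ, h1φ⟩ := hφ
    obtain ⟨hTψ, h1ψ⟩ := hψ
    have hu : φ.1 = ψ.1 := Subtype.ext h
    have hw : φ.2.2 = ψ.2.2 := by
      apply Subtype.ext; funext i
      have e1 : φ.1.1 i = ψ.1.1 i := by rw [hu]
      have e2 : φ.2.1.1 i = ψ.2.1.1 i := by rw [h1φ, h1ψ]
      exact fin3_third_unique _ _ _ _ (hTφ i).1 (hTφ i).2.1 (hTφ i).2.2
        (by rw [e1]; exact (hTψ i).2.1) (by rw [e2]; exact (hTψ i).2.2)
    exact Prod.ext hu (Prod.ext (h1φ.trans h1ψ.symm) hw)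

/-- Fibres of `Φ_τ` over the third word have size `≤ 2^{|K|}`. [folklore] -/
private theorem fibre_thd_le (c : ClsL τ) :
    ((cls τ).filter fun φ => φ.2.2 = c).card ≤ 2 ^ Fintype.card K := by
  classical
  rw [← card_avoid c.1]
  refine Finset.card_le_card_of_injOn (fun φ => φ.1.1) ?_ ?_
  · intro φ hφ
    simp only [coe_filter, Set.mem_setOf_eq, cls, mem_filter, mem_univ, true_and, mem_transversal,
      forget, Function.Embedding.coeFn_mk] at hφ
    obtain ⟨hT, rfl⟩ := hφ
    exact Finset.mem_coe.2 (Fintype.mem_piFinset.2 fun i =>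
      Finset.mem_filter.2 ⟨Finset.mem_univ _, (hT i).2.1⟩)
  · intro φ hφ ψ hψ h
    simp only [coe_filter, Set.mem_setOf_eq, cls, mem_filter, mem_univ, true_and, mem_transversal,
      forget, Function.Embedding.coeFn_mk] at hφ hψ
    obtain ⟨hTφ, h1φ⟩ := hφ
    obtain ⟨hTψ, h1ψ⟩ := hψ
    have hu : φ.1 = ψ.1 := Subtype.ext h
    have hv : φ.2.1 = ψ.2.1 := by
      apply Subtype.ext; funext i
      have e1 : φ.1.1 i = ψ.1.1 i := by rw [hu]
      have e3 : φ.2.2.1 i = ψ.2.2.1 i := by rw [h1φ, h1ψ]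
      exact fin3_third_unique _ _ _ _ (hTφ i).2.1 (hTφ i).1 (Ne.symm (hTφ i).2.2)
        (by rw [e1]; exact (hTψ i).1) (by rw [e3]; exact Ne.symm (hTψ i).2.2)
    exact Prod.ext hu (Prod.ext hv (h1φ.trans h1ψ.symm))

/-- THE HASHING STEP: `Φ_τ` contains a diagonal `Δ`, free in `Φ_τ`, with
`|Φ_τ|·|D|·(M - 3·2^{|K|}) ≤ M³|Δ|` for every prime `M > 4` and every Salem–Spencer diagonal `D`
in `ℤ/M` — the tree's `BCS1997_thm1539_free` applied to the `2`-tight coordinates `u, v, w-3`.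
[cite: BurgisserClausenShokrollahi1997, Thm. 15.39] -/
theorem exists_free_in_cls {M : ℕ} (hM : M.Prime) (h4 : 4 < M) :
    ∃ Δ : Finset (ClsI τ × ClsJ τ × ClsL τ), Δ ⊆ cls τ ∧
      (∀ δ ∈ Δ, ∀ δ' ∈ Δ, ∀ δ'' ∈ Δ, (δ.1, δ'.2.1, δ''.2.2) ∈ cls τ → δ = δ' ∧ δ' = δ'') ∧
      ((cls τ).card : ℝ) * rothNumberNat (M / 2) * ((M : ℝ) - 3 * 2 ^ Fintype.card K) ≤
        (M : ℝ) ^ 3 * Δ.card := by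
  classical
  haveI : NeZero M := ⟨hM.ne_zero⟩
  obtain ⟨D₁, D₂, D₃, hD₁, hD₂, hD₃, hroth⟩ := exists_zeroSum_diagonal M (M / 2) (by omega)
  set e := Fintype.equivFin K with he
  let α : ClsI τ → Fin (Fintype.card K) → ℤ := fun a ρ => ((a.1 (e.symm ρ) : ℕ) : ℤ)
  let β : ClsJ τ → Fin (Fintype.card K) → ℤ := fun b ρ => ((b.1 (e.symm ρ) : ℕ) : ℤ)
  let γ : ClsL τ → Fin (Fintype.card K) → ℤ := fun c ρ => ((c.1 (e.symm ρ) : ℕ) : ℤ) - 3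
  have hinjw : ∀ u u' : K → Fin 3,
      (fun ρ => ((u (e.symm ρ) : ℕ) : ℤ)) = (fun ρ => ((u' (e.symm ρ) : ℕ) : ℤ)) → u = u' := by
    intro u u' h
    funext i
    have := congrFun h (e i)
    simp only [Equiv.symm_apply_apply, Nat.cast_inj] at this
    exact Fin.ext this
  have hα : Function.Injective α := fun a a' h => Subtype.ext (hinjw _ _ h)
  have hβ : Function.Injective β := fun b b' h => Subtype.ext (hinjw _ _ h)
  have hγ : Function.Injective γ := by
    intro c c' h
    apply Subtype.ext; apply hinjw
    funext ρ
    have := congrFun h ρ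
    simpa [γ] using this
  have hbnd : ∀ (u : K → Fin 3) (ρ : Fin (Fintype.card K)), |((u (e.symm ρ) : ℕ) : ℤ)| ≤ (2 : ℕ) := by
    intro u ρ
    rw [abs_of_nonneg (by positivity)]
    have := (u (e.symm ρ)).is_lt
    push_cast
    omega
  have htight : ∀ φ ∈ cls τ, ∀ ρ, α φ.1 ρ + β φ.2.1 ρ + γ φ.2.2 ρ = 0 := by
    intro φ hφ ρ
    simp only [cls, mem_filter, mem_univ, true_and, mem_transversal] at hφ
    simp only [forget, Function.Embedding.coeFn_mk] at hφ
    have h3 := fin3_sum_of_distinct _ _ _ (hφ (e.symm ρ)).1 (hφ (e.symm ρ)).2.1 (hφ (e.symm ρ)).2.2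
    have h3' : ((φ.1.1 (e.symm ρ) : ℕ) : ℤ) + ((φ.2.1.1 (e.symm ρ) : ℕ) : ℤ) +
        ((φ.2.2.1 (e.symm ρ) : ℕ) : ℤ) = 3 := by exact_mod_cast h3
    simp only [α, β, γ]
    linear_combination h3'
  obtain ⟨Δ, hΔ, hfree, hsize⟩ := BCS1997_thm1539_free (cls τ) α β γ hα hβ hγ
    (fun a ρ => hbnd a.1 ρ) (fun b ρ => hbnd b.1 ρ) htight
    (fibre_fst_le τ) (fibre_snd_le τ) (fibre_thd_le τ) hM (by omega) D₁ D₂ D₃ hD₁ hD₂ hD₃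
  refine ⟨Δ, hΔ, hfree, ?_⟩
  have hsize' : ((cls τ).card : ℝ) *
      (((D₁ ×ˢ D₂ ×ˢ D₃).filter fun d => d.1 + d.2.1 + d.2.2 = 0).card : ℝ) *
        ((M : ℝ) - 3 * 2 ^ Fintype.card K) ≤ (M : ℝ) ^ 3 * Δ.card := by
    exact_mod_cast hsize
  by_cases hpos : (0 : ℝ) ≤ (M : ℝ) - 3 * 2 ^ Fintype.card K
  · have hroth' : (rothNumberNat (M / 2) : ℝ) ≤
        (((D₁ ×ˢ D₂ ×ˢ D₃).filter fun d => d.1 + d.2.1 + d.2.2 = 0).card : ℝ) := by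
      exact_mod_cast hroth
    calc ((cls τ).card : ℝ) * rothNumberNat (M / 2) * ((M : ℝ) - 3 * 2 ^ Fintype.card K)
        ≤ ((cls τ).card : ℝ) *
          (((D₁ ×ˢ D₂ ×ˢ D₃).filter fun d => d.1 + d.2.1 + d.2.2 = 0).card : ℝ) *
            ((M : ℝ) - 3 * 2 ^ Fintype.card K) :=
          mul_le_mul_of_nonneg_right (mul_le_mul_of_nonneg_left hroth' (by positivity)) hpos
      _ ≤ _ := hsize'
  · push Not at hpos
    calc ((cls τ).card : ℝ) * rothNumberNat (M / 2) * ((M : ℝ) - 3 * 2 ^ Fintype.card K)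
        ≤ 0 := mul_nonpos_of_nonneg_of_nonpos (by positivity) hpos.le
      _ ≤ _ := by positivity

end OneClass

/-! ## Assembly: a large free diagonal in every `S_K` -/

/-- `x ↦ e^{-4√(log x)}` is antitone on `(0, ∞)`. [folklore] -/
private theorem exp_neg_sqrt_log_antitone {a b : ℝ} (ha : 0 < a) (hab : a ≤ b) :
    exp (-4 * √(log b)) ≤ exp (-4 * √(log a)) := by
  apply exp_le_exp.2
  have := sqrt_le_sqrt (log_le_log ha hab)
  linarith

/-- **Strassen's free diagonal, quantitative form**: every `S_K` contains a free diagonal (a family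
of transversal triples whose only transversal recombination `(x₁, y₂, z₃)` is `x = y = z`) of size
`≥ 3^{|K|} e^{-4√(log(12·2^{|K|}))} / (96 (|K|+1)^9)`.
[cite: Strassen1991, §6 (via BurgisserClausenShokrollahi1997 Thm. 15.39)] -/
theorem exists_freeDiagonal_card_ge (K : Type) [Fintype K] [DecidableEq K] :
    ∃ D : Finset ((K → Fin 3) × (K → Fin 3) × (K → Fin 3)),
      (∀ x ∈ D, ∀ i, x.1 i ≠ x.2.1 i ∧ x.1 i ≠ x.2.2 i ∧ x.2.1 i ≠ x.2.2 i) ∧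
      (∀ x ∈ D, ∀ y ∈ D, ∀ z ∈ D,
        (∀ i, x.1 i ≠ y.2.1 i ∧ x.1 i ≠ z.2.2 i ∧ y.2.1 i ≠ z.2.2 i) → x = y ∧ y = z) ∧
      (3 : ℝ) ^ Fintype.card K * exp (-4 * √(log (12 * 2 ^ Fintype.card K))) /
          (96 * (Fintype.card K + 1) ^ 9) ≤ D.card := by
  classical
  obtain ⟨τ, hτ⟩ := exists_big_class (K := K)
  rw [← card_cls] at hτ
  have hB : (6 : ℝ) ^ Fintype.card K ≤ ((Fintype.card K : ℝ) + 1) ^ 9 * ((cls τ).card : ℝ) := by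
    exact_mod_cast hτ
  set k := Fintype.card K with hk
  -- a prime `6·2^k < M ≤ 12·2^k`
  obtain ⟨M, hMp, hMlt, hMle⟩ := Nat.exists_prime_lt_and_le_two_mul (6 * 2 ^ k) (by positivity)
  have h2k : 1 ≤ 2 ^ k := Nat.one_le_two_pow
  have h4 : 4 < M := by
    have : 6 ≤ 6 * 2 ^ k := by nlinarith
    omega
  obtain ⟨Δ, hΔ, hfree, hsize⟩ := exists_free_in_cls τ hMp h4
  refine ⟨Δ.map (forget τ), ?_, ?_, ?_⟩
  · intro x hx
    obtain ⟨φ, hφ, rfl⟩ := Finset.mem_map.1 hx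
    have := hΔ hφ
    simp only [cls, mem_filter, mem_univ, true_and, mem_transversal] at this
    exact this
  · intro x hx y hy z hz hxyz
    obtain ⟨φ, hφ, rfl⟩ := Finset.mem_map.1 hx
    obtain ⟨ψ, hψ, rfl⟩ := Finset.mem_map.1 hy
    obtain ⟨χ, hχ, rfl⟩ := Finset.mem_map.1 hz
    have hmem : (φ.1, ψ.2.1, χ.2.2) ∈ cls τ := by
      simp only [cls, mem_filter, mem_univ, true_and, mem_transversal, forget,
        Function.Embedding.coeFn_mk]
      simpa [forget] using hxyz
    obtain ⟨h1, h2⟩ := hfree φ hφ ψ hψ χ hχ hmem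
    exact ⟨by rw [h1], by rw [h2]⟩
  · -- sizes
    rw [card_map]
    set E : ℝ := exp (-4 * √(log (12 * 2 ^ k))) with hE
    set Φc : ℝ := ((cls τ).card : ℝ) with hΦc
    set Δc : ℝ := (Δ.card : ℝ) with hΔc
    have hM0 : (0 : ℝ) < M := by exact_mod_cast hMp.pos
    have hMle' : (M : ℝ) ≤ 12 * 2 ^ k := by
      have : (M : ℝ) ≤ (2 * (6 * 2 ^ k) : ℕ) := by exact_mod_cast hMle
      push_cast at this; linarith
    have hMlt' : (6 : ℝ) * 2 ^ k < M := by exact_mod_cast hMlt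
    have hE0 : 0 < E := exp_pos _
    -- Behrend + bookkeeping: roth(M/2) ≥ (M/4)·E
    have hroth : (M : ℝ) / 4 * E ≤ rothNumberNat (M / 2) := by
      have hb := Behrend.roth_lower_bound (N := M / 2)
      have hhalf : (M : ℝ) / 4 ≤ ((M / 2 : ℕ) : ℝ) := by
        have : M ≤ 2 * (M / 2) + 1 := by omega
        have : (M : ℝ) ≤ 2 * ((M / 2 : ℕ) : ℝ) + 1 := by exact_mod_cast this
        have hM5 : (5 : ℝ) ≤ M := by exact_mod_cast h4
        linarith
      have hhalfpos : (0 : ℝ) < ((M / 2 : ℕ) : ℝ) := by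
        have : 0 < M / 2 := by omega
        exact_mod_cast this
      have hEle : E ≤ exp (-4 * √(log ((M / 2 : ℕ) : ℝ))) := by
        apply exp_neg_sqrt_log_antitone hhalfpos
        have : ((M / 2 : ℕ) : ℝ) ≤ M := by exact_mod_cast Nat.div_le_self M 2
        linarith
      calc (M : ℝ) / 4 * E ≤ ((M / 2 : ℕ) : ℝ) * exp (-4 * √(log ((M / 2 : ℕ) : ℝ))) :=
            mul_le_mul hhalf hEle hE0.le hhalfpos.le
        _ ≤ _ := hb
    -- the hashing inequality, simplified: Φc · E · M² / 8 ≤ M³ · Δc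
    have hA : Φc * E * (M : ℝ) ^ 2 / 8 ≤ (M : ℝ) ^ 3 * Δc := by
      have h3f : (M : ℝ) / 2 ≤ (M : ℝ) - 3 * 2 ^ k := by linarith
      calc Φc * E * (M : ℝ) ^ 2 / 8 = Φc * ((M : ℝ) / 4 * E) * ((M : ℝ) / 2) := by ring
        _ ≤ Φc * rothNumberNat (M / 2) * ((M : ℝ) - 3 * 2 ^ k) :=
            mul_le_mul (mul_le_mul_of_nonneg_left hroth (by positivity)) h3f (by positivity)
              (by positivity)
        _ ≤ _ := hsize
    have hA' : Φc * E ≤ 8 * M * Δc := by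
      by_contra hlt
      push Not at hlt
      have := mul_lt_mul_of_pos_right hlt (by positivity : (0 : ℝ) < (M : ℝ) ^ 2)
      nlinarith
    -- conclusion
    have hk9 : (0 : ℝ) < ((k : ℝ) + 1) ^ 9 := by positivity
    calc (3 : ℝ) ^ k * E / (96 * ((k : ℝ) + 1) ^ 9)
        = (6 : ℝ) ^ k * E / (8 * (12 * 2 ^ k) * ((k : ℝ) + 1) ^ 9) := by
          rw [show (6 : ℝ) ^ k = 3 ^ k * 2 ^ k by rw [← mul_pow]; norm_num]
          field_simp
          ring
      _ ≤ (6 : ℝ) ^ k * E / (8 * M * ((k : ℝ) + 1) ^ 9) := by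
          apply div_le_div_of_nonneg_left (by positivity) (by positivity)
          gcongr
      _ ≤ ((k : ℝ) + 1) ^ 9 * Φc * E / (8 * M * ((k : ℝ) + 1) ^ 9) := by
          gcongr
      _ = Φc * E / (8 * M) := by
          field_simp
      _ ≤ Δc := by
          rw [div_le_iff₀ (by positivity)]
          linarith

/-! ## The subexponential losses and the named fact -/

/-- The losses are subexponential: `(3-η)^k ≤ 3^k e^{-4√(log(12·2^k))}/(96(k+1)^9)` for
`k ≥ k₀(η)`. [folklore] -/
private theorem eventually_le_bound {η : ℝ} (hη : 0 < η) (hη1 : η < 1) :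
    ∃ k₀ : ℕ, ∀ k : ℕ, k₀ ≤ k →
      (3 - η) ^ k ≤ (3 : ℝ) ^ k * exp (-4 * √(log (12 * 2 ^ k))) / (96 * (k + 1) ^ 9) := by
  set r : ℝ := (3 - η) / 3 with hr
  have hr0 : 0 < r := by rw [hr]; exact div_pos (by linarith) (by norm_num)
  have hr1 : r < 1 := by rw [hr, div_lt_one (by norm_num)]; linarith
  set s : ℝ := (1 + r) / 2 with hs
  have hs0 : 0 < s := by rw [hs]; linarith
  have hs1 : s < 1 := by rw [hs]; linarith
  have hrs : r < s := by rw [hs]; linarith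
  have hsr : 1 < s / r := (one_lt_div hr0).2 hrs
  set L : ℝ := log (s / r) with hL
  have hL0 : 0 < L := Real.log_pos hsr
  set c : ℝ := log 12 + log 2 with hc
  have hc0 : 0 < c := by
    rw [hc]; exact add_pos (Real.log_pos (by norm_num)) (Real.log_pos (by norm_num))
  -- Step 1: the stretched exponential is eventually dominated by `(s/r)^k`
  have step1 : ∀ k : ℕ, 1 ≤ k → 16 * c / L ^ 2 ≤ k →
      exp (4 * √(log (12 * 2 ^ k))) * r ^ k ≤ s ^ k := by
    intro k hk1 hkT
    have hk1' : (1 : ℝ) ≤ k := by exact_mod_cast hk1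
    have hlog : log (12 * 2 ^ k) = log 12 + k * log 2 := by
      rw [Real.log_mul (by norm_num) (by positivity), Real.log_pow]
    have hle_ck : log (12 * 2 ^ k) ≤ c * k := by
      rw [hlog, hc]
      have h12 : 0 ≤ log 12 := Real.log_nonneg (by norm_num)
      nlinarith
    have hsq : 4 * √(log (12 * 2 ^ k)) ≤ L * k := by
      have h1 : √(log (12 * 2 ^ k)) ≤ √(c * k) := sqrt_le_sqrt hle_ck
      have h2 : √(c * k) = √c * √k := sqrt_mul hc0.le k
      have h3 : 4 * √c ≤ L * √k := by
        have hq : 4 * √c / L ≤ √k := by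
          rw [Real.le_sqrt (by positivity) (by positivity)]
          calc (4 * √c / L) ^ 2 = 16 * c / L ^ 2 := by
                rw [div_pow, mul_pow, sq_sqrt hc0.le]; ring
            _ ≤ (k : ℝ) := hkT
        calc 4 * √c = (4 * √c / L) * L := by field_simp
          _ ≤ √k * L := by gcongr
          _ = L * √k := mul_comm _ _
      calc 4 * √(log (12 * 2 ^ k)) ≤ 4 * (√c * √k) := by rw [← h2]; gcongr
        _ = (4 * √c) * √k := by ring
        _ ≤ (L * √k) * √k := by gcongr
        _ = L * k := by rw [mul_assoc, Real.mul_self_sqrt (by positivity)]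
    have hexpL : exp (L * k) = (s / r) ^ k := by
      rw [← Real.rpow_natCast, Real.rpow_def_of_pos (by positivity), hL]
    calc exp (4 * √(log (12 * 2 ^ k))) * r ^ k ≤ exp (L * k) * r ^ k := by gcongr
      _ = (s / r) ^ k * r ^ k := by rw [hexpL]
      _ = s ^ k := by rw [div_pow, div_mul_cancel₀ _ (pow_ne_zero _ hr0.ne')]
  -- Step 2: the polynomial factor is beaten by `s^k`
  have lim0 : Tendsto (fun n : ℕ => (n : ℝ) ^ 9 * s ^ n) atTop (𝓝 0) :=
    tendsto_pow_const_mul_const_pow_of_lt_one 9 hs0.le hs1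
  have lim1 : Tendsto (fun k : ℕ => (((k + 1 : ℕ) : ℝ)) ^ 9 * s ^ (k + 1)) atTop (𝓝 0) :=
    (tendsto_add_atTop_iff_nat 1).2 lim0
  have lim2 : Tendsto (fun k : ℕ => 96 / s * ((((k + 1 : ℕ) : ℝ)) ^ 9 * s ^ (k + 1)))
      atTop (𝓝 0) := by
    simpa using lim1.const_mul (96 / s)
  obtain ⟨k₂, hk₂⟩ := eventually_atTop.1 (lim2.eventually (gt_mem_nhds zero_lt_one))
  refine ⟨max (max 1 ⌈16 * c / L ^ 2⌉₊) k₂, fun k hk => ?_⟩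
  have hk1 : 1 ≤ k := le_trans (le_trans (le_max_left _ _) (le_max_left _ _)) hk
  have hkT : 16 * c / L ^ 2 ≤ k :=
    (Nat.ceil_le).1 (le_trans (le_trans (le_max_right _ _) (le_max_left _ _)) hk)
  have hk2 : 96 / s * ((((k + 1 : ℕ) : ℝ)) ^ 9 * s ^ (k + 1)) < 1 := hk₂ k (le_trans (le_max_right _ _) hk)
  have hpoly : 96 * ((k : ℝ) + 1) ^ 9 * s ^ k < 1 := by
    have : 96 / s * ((((k + 1 : ℕ) : ℝ)) ^ 9 * s ^ (k + 1)) = 96 * ((k : ℝ) + 1) ^ 9 * s ^ k := by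
      push_cast
      field_simp
      ring
    linarith [this ▸ hk2]
  -- combine
  have hpos96 : (0 : ℝ) < 96 * ((k : ℝ) + 1) ^ 9 := by positivity
  rw [le_div_iff₀ hpos96]
  have h3η : (3 - η) ^ k = (3 : ℝ) ^ k * r ^ k := by
    rw [hr, ← mul_pow]; congr 1; field_simp
  rw [h3η]
  have key : r ^ k * (96 * ((k : ℝ) + 1) ^ 9) * exp (4 * √(log (12 * 2 ^ k))) ≤ 1 := by
    calc r ^ k * (96 * ((k : ℝ) + 1) ^ 9) * exp (4 * √(log (12 * 2 ^ k)))
        = (96 * ((k : ℝ) + 1) ^ 9) * (exp (4 * √(log (12 * 2 ^ k))) * r ^ k) := by ring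
      _ ≤ (96 * ((k : ℝ) + 1) ^ 9) * s ^ k := by gcongr; exact step1 k hk1 hkT
      _ ≤ 1 := by linarith
  have hexp0 : 0 < exp (4 * √(log (12 * 2 ^ k))) := exp_pos _
  have hEinv : exp (-4 * √(log (12 * 2 ^ k))) = (exp (4 * √(log (12 * 2 ^ k))))⁻¹ := by
    rw [neg_mul, Real.exp_neg]
  rw [hEinv]
  calc (3 : ℝ) ^ k * r ^ k * (96 * ((k : ℝ) + 1) ^ 9)
      = 3 ^ k * (r ^ k * (96 * ((k : ℝ) + 1) ^ 9) * exp (4 * √(log (12 * 2 ^ k)))) *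
          (exp (4 * √(log (12 * 2 ^ k))))⁻¹ := by
        field_simp
    _ ≤ 3 ^ k * 1 * (exp (4 * √(log (12 * 2 ^ k))))⁻¹ := by gcongr
    _ = 3 ^ k * (exp (4 * √(log (12 * 2 ^ k))))⁻¹ := by ring

end XyzFreeDiagonal

open XyzFreeDiagonal in
/-- **Strassen's free-diagonal theorem for `S₁`** — discharge of the named fact
`XyzFreeDiagonalHypothesis`: for every `0 < η < 1` there is `k₀` such that every `S_K` with
`|K| ≥ k₀` contains a free diagonal of size `≥ (3-η)^{|K|}`.
[cite: Strassen1991, §6; ChristandlVranaZuiddam2023, Thm. 4.4 (arXiv numbering)] -/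
theorem XyzFreeDiagonalHypothesis_holds : XyzFreeDiagonalHypothesis := by
  intro η hη hη1
  obtain ⟨k₀, hk₀⟩ := eventually_le_bound hη hη1
  refine ⟨k₀, fun K _ _ hK => ?_⟩
  obtain ⟨D, hD1, hD2, hD3⟩ := exists_freeDiagonal_card_ge K
  exact ⟨D, hD1, hD2, (hk₀ _ hK).trans hD3⟩

end Literature.Computability.AlgebraicComplexity
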